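import Mathlib
import Summits.Ventures.PercRepro2.SwOutCrossBaseReal

/-!
# The cross base: the red hull formula (blind cell PercRepro2, night-4 g23, 2026-08-28;
proofs/NIGHT4-G23.md §10, step (2))

At a point of the cube whose fibre has no red-side leak (when some u-arm is red), the red cluster
of `h` in the realisation is `redSetX`: `h`, the red u-arms, `u` when some u-arm is red, the
ATTACHED dropped vertices (attachment transitive along the red cross edges, `attE`) when some u-arm
is red, and the red far arms (**`cluster_crossReal`**).  Closure under red adjacency
(`redSetX_closed`): an outside edge of an attached vertex is red only at a leak, a cross edge of an
attached vertex attaches its other end; the reverse inclusion maps a walk of the link graph to a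
red path of the realisation (`conn_of_linkWalk`).
-/

namespace Summit.Ventures.PercRepro2

namespace CrossArm

open Hull LocRows

variable {V : Type*} {E : Type*}

open scoped Classical

section RedSet

variable (h u : V) {ι X κ : Type*} (U : ι → Set V) (p : X → V) (G : SimpleGraph X) (F : κ → Set V)

/-- The red cluster of `h` predicted at a point `(f, s, w)`. -/
def redSetX (q : PtXG ι κ X G) : Set V :=
  {h} ∪ {x | ∃ j, q.2.1 j = true ∧ x ∈ U j} ∪ {x | x = u ∧ ∃ j, q.2.1 j = true} ∪
    {x | ∃ i, x = p i ∧ (∃ j, q.2.1 j = true) ∧ attE G q.2.2 i} ∪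
    {x | ∃ k, q.1 k = true ∧ x ∈ F k}

/-- The red-side leak of a point: some u-arm red and an attached vertex with red outside edges. -/
def LeakRX (q : PtXG ι κ X G) : Prop :=
  (∃ j, q.2.1 j = true) ∧ ∃ i, attE G q.2.2 i ∧ q.2.2.2.2 i = false

end RedSet

section Hull

variable {ends : E → Sym2 V} {σ : Config E} {h u : V} {ι X κ : Type*} {U : ι → Set V}
  {p : X → V} {G : SimpleGraph X} {F : κ → Set V} (hb : CrossBase ends σ h u U p G F)
include hb

omit hb in
/-- Membership in `redSetX`. -/
lemma mem_redSetX_iff {q : PtXG ι κ X G} {x : V} :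
    x ∈ redSetX h u U p G F q ↔ x = h ∨ (∃ j, q.2.1 j = true ∧ x ∈ U j) ∨
      (x = u ∧ ∃ j, q.2.1 j = true) ∨ (∃ i, x = p i ∧ (∃ j, q.2.1 j = true) ∧ attE G q.2.2 i) ∨
      ∃ k, q.1 k = true ∧ x ∈ F k := by
  simp only [redSetX, Set.mem_union, Set.mem_singleton_iff, Set.mem_setOf_eq, or_assoc]

/-- An edge inside `U j ∪ {h}` touches `U j`. -/
lemma CrossBase.touches_U_of_within {j : ι} {e : E} (he : e ∈ within ends (U j ∪ {h})) :
    e ∈ touches ends (U j) := by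
  obtain ⟨x, hx, y, hy, hxy⟩ := he
  rcases hx with hx | hx
  · exact ⟨x, hx, y, hxy⟩
  · rcases hy with hy | hy
    · exact ⟨y, hy, x, ends_swap hxy⟩
    · exfalso
      rw [Set.mem_singleton_iff] at hx hy
      subst hx
      subst hy
      exact hb.loop_h e hxy

/-- An edge inside `F k ∪ {h}` touches `F k`. -/
lemma CrossBase.touches_F_of_within {k : κ} {e : E} (he : e ∈ within ends (F k ∪ {h})) :
    e ∈ touches ends (F k) := by
  obtain ⟨x, hx, y, hy, hxy⟩ := he
  rcases hx with hx | hx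
  · exact ⟨x, hx, y, hxy⟩
  · rcases hy with hy | hy
    · exact ⟨y, hy, x, ends_swap hxy⟩
    · exfalso
      rw [Set.mem_singleton_iff] at hx hy
      subst hx
      subst hy
      exact hb.loop_h e hxy

/-- An edge touching `U j` has an end in `U j` and the other end in `U j`, at `h`, at `u`, or
outside everything. -/
lemma CrossBase.ends_of_touches_U {j : ι} {e : E} (he : e ∈ touches ends (U j)) :
    ∃ x y, ends e = s(x, y) ∧ x ∈ U j ∧
      (y ∈ U j ∨ y = h ∨ y = u ∨ (y ≠ h ∧ y ≠ u ∧ (∀ i, y ≠ p i) ∧ y ∉ armsAllX U F)) := by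
  obtain ⟨x, hx, y, hxy⟩ := he
  refine ⟨x, y, hxy, hx, ?_⟩
  by_cases hyU : y ∈ U j
  · exact Or.inl hyU
  by_cases hyh : y = h
  · exact Or.inr (Or.inl hyh)
  by_cases hyu : y = u
  · exact Or.inr (Or.inr (Or.inl hyu))
  refine Or.inr (Or.inr (Or.inr ⟨hyh, hyu, fun i hi => ?_, fun hy => ?_⟩))
  · rw [hi] at hxy
    exact hb.no_pU (ends_swap hxy) j hx
  · rcases hy with hy | hy
    · obtain ⟨j', hj'⟩ := Set.mem_iUnion.1 hy
      have hne : j ≠ j' := by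
        rintro rfl
        exact hyU hj'
      exact hb.no_cross_UU j j' hne e x y hxy hx hj'
    · obtain ⟨k, hk⟩ := Set.mem_iUnion.1 hy
      exact hb.no_cross_UF j k e x y hxy hx hk

/-- An edge touching `F k` has an end in `F k` and the other end in `F k`, at `h`, or outside
everything. -/
lemma CrossBase.ends_of_touches_F {k : κ} {e : E} (he : e ∈ touches ends (F k)) :
    ∃ x y, ends e = s(x, y) ∧ x ∈ F k ∧
      (y ∈ F k ∨ y = h ∨ (y ≠ h ∧ y ≠ u ∧ (∀ i, y ≠ p i) ∧ y ∉ armsAllX U F)) := by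
  obtain ⟨x, hx, y, hxy⟩ := he
  refine ⟨x, y, hxy, hx, ?_⟩
  by_cases hyF : y ∈ F k
  · exact Or.inl hyF
  by_cases hyh : y = h
  · exact Or.inr (Or.inl hyh)
  refine Or.inr (Or.inr ⟨hyh, fun hyu => ?_, fun i hi => ?_, fun hy => ?_⟩)
  · rw [hyu] at hxy
    exact hb.no_uF (ends_swap hxy) k hx
  · rw [hi] at hxy
    exact hb.no_pF (ends_swap hxy) k hx
  · rcases hy with hy | hy
    · obtain ⟨j, hj⟩ := Set.mem_iUnion.1 hy
      exact hb.no_cross_UF j k e y x (ends_swap hxy) hj hx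
    · obtain ⟨k', hk'⟩ := Set.mem_iUnion.1 hy
      have hne : k ≠ k' := by
        rintro rfl
        exact hyF hk'
      exact hb.no_cross_FF k k' hne e x y hxy hx hk'

/-- The colour of an edge touching a red u-arm is the base colour. -/
lemma CrossBase.crossReal_U_red {q : PtXG ι κ X G} {j : ι} (hj : q.2.1 j = true) {e : E}
    (he : e ∈ touches ends (U j)) : crossReal ends u U p G F σ q e = σ e := by
  rw [hb.crossReal_apply_U he, if_pos hj]

/-- The colour of an edge touching a red far arm is the base colour. -/
lemma CrossBase.crossReal_F_red {q : PtXG ι κ X G} {k : κ} (hk : q.1 k = true) {e : E}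
    (he : e ∈ touches ends (F k)) : crossReal ends u U p G F σ q e = σ e := by
  rw [hb.crossReal_apply_F he, if_pos hk]

/-- **Closure**: at a point without red-side leak, `redSetX` is closed under red adjacency. -/
theorem CrossBase.redSetX_closed {q : PtXG ι κ X G} (hq : ¬ LeakRX G q) :
    ∀ x ∈ redSetX h u U p G F q, ∀ y,
      (openGraph ends (crossReal ends u U p G F σ q)).Adj x y → y ∈ redSetX h u U p G F q := by
  intro x hx y hxy
  obtain ⟨_, e, he, hends⟩ := openGraph_adj.1 hxy
  rw [mem_redSetX_iff] at hx ⊢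
  rcases hx with hxh | ⟨j, hj, hx⟩ | ⟨hxu, j, hj⟩ | ⟨i, hxp, ⟨j, hj⟩, hatt⟩ | ⟨k, hk, hx⟩
  · -- x = h: the edge enters a u-arm or a far arm, red iff the arm's coordinate is `true`
    rw [hxh] at hends
    rcases hb.h_edges e y hends with ⟨j, hy⟩ | ⟨k, hy⟩
    · have ht : e ∈ touches ends (U j) := ⟨y, hy, h, ends_swap hends⟩
      rw [hb.crossReal_apply_U ht] at he
      by_cases hj : q.2.1 j = true
      · exact Or.inr (Or.inl ⟨j, hj, hy⟩)
      · rw [if_neg hj, hb.h_red e y hends] at he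
        exact absurd he (by decide)
    · have ht : e ∈ touches ends (F k) := ⟨y, hy, h, ends_swap hends⟩
      rw [hb.crossReal_apply_F ht] at he
      by_cases hk : q.1 k = true
      · exact Or.inr (Or.inr (Or.inr (Or.inr ⟨k, hk, hy⟩)))
      · rw [if_neg hk, hb.h_red e y hends] at he
        exact absurd he (by decide)
  · -- x in a red u-arm: inside, to h, to u, or outside (blue)
    have ht : e ∈ touches ends (U j) := ⟨x, hx, y, hends⟩
    rw [hb.crossReal_U_red hj ht] at he
    obtain ⟨x', y', hxy', hx', hy'⟩ := hb.ends_of_touches_U ht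
    rw [hends, Sym2.eq_iff] at hxy'
    rcases hxy' with ⟨h1, h2⟩ | ⟨h1, h2⟩
    · rw [← h2] at hy'
      rcases hy' with hy | hyh | hyu | ⟨hyh, hyu, hyp, hout⟩
      · exact Or.inr (Or.inl ⟨j, hj, hy⟩)
      · exact Or.inl hyh
      · exact Or.inr (Or.inr (Or.inl ⟨hyu, j, hj⟩))
      · rw [hb.bdry_blue e x y hends (Or.inl (Set.mem_iUnion.2 ⟨j, hx⟩)) hyh hyu hyp hout] at he
        exact absurd he (by decide)
    · rw [← h2] at hx'
      exact Or.inr (Or.inl ⟨j, hj, hx'⟩)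
  · -- x = u (some red u-arm): the edge goes into a u-arm or to a dropped vertex
    rw [hxu] at hends
    rcases hb.u_edges e y hends with ⟨j', hy⟩ | ⟨i, hyp⟩
    · have ht : e ∈ touches ends (U j') := ⟨y, hy, u, ends_swap hends⟩
      rw [hb.crossReal_apply_U ht] at he
      by_cases hj' : q.2.1 j' = true
      · exact Or.inr (Or.inl ⟨j', hj', hy⟩)
      · rw [if_neg hj', hb.u_red e y hends] at he
        exact absurd he (by decide)
    · rw [hyp] at hends
      have ht : e ∈ clsUPX ends u p i := hends
      rw [hb.crossReal_apply_UP ht] at he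
      by_cases huP : q.2.2.1 i = true
      · exact Or.inr (Or.inr (Or.inr (Or.inl ⟨i, hyp, ⟨j, hj⟩, attE_of_uP G huP⟩)))
      · rw [if_neg huP, hb.u_red e (p i) hends] at he
        exact absurd he (by decide)
  · -- x = p i attached: its edges go to u, along a cross edge, or outside
    rw [hxp] at hends
    rcases hb.p_edges i e y hends with hyu | ⟨i', hyp', hadj⟩ | ⟨hyh, hyu, hyp, hyarms⟩
    · exact Or.inr (Or.inr (Or.inl ⟨hyu, j, hj⟩))
    · -- a cross edge: red iff its class is red, and then the other end is attached
      rw [hyp'] at hends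
      have ht : e ∈ clsCX ends p G ⟨s(i, i'), G.mem_edgeSet.2 hadj⟩ := ⟨i, i', rfl, hends⟩
      rw [hb.crossReal_apply_C ht] at he
      by_cases hc : q.2.2.2.1 ⟨s(i, i'), G.mem_edgeSet.2 hadj⟩ = true
      · refine Or.inr (Or.inr (Or.inr (Or.inl ⟨i', hyp', ⟨j, hj⟩, ?_⟩)))
        have hc' : q.2.2.2.1 ⟨s(i', i), G.mem_edgeSet.2 hadj.symm⟩ = true := by
          have : (⟨s(i', i), G.mem_edgeSet.2 hadj.symm⟩ : G.edgeSet) =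
              ⟨s(i, i'), G.mem_edgeSet.2 hadj⟩ := Subtype.ext Sym2.eq_swap
          rw [this]; exact hc
        exact attE_of_adj G hadj.symm hc' hatt
      · rw [if_neg hc, hb.cross_red i i' e hends] at he
        exact absurd he (by decide)
    · -- an outside edge: red only when `e i = false` — excluded by the leak condition
      have ht : e ∈ clsExtX ends u p i := ⟨y, hends, hyu, hyp⟩
      rw [hb.crossReal_apply_Ext ht] at he
      by_cases hc : q.2.2.2.2 i = true
      · rw [if_pos hc, hb.ext_blue i e y hends hyu hyp] at he
        exact absurd he (by decide)
      · exact absurd ⟨⟨j, hj⟩, i, hatt, by simpa using hc⟩ hq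
  · -- x in a red far arm: inside, to h, or outside (blue)
    have ht : e ∈ touches ends (F k) := ⟨x, hx, y, hends⟩
    rw [hb.crossReal_F_red hk ht] at he
    obtain ⟨x', y', hxy', hx', hy'⟩ := hb.ends_of_touches_F ht
    rw [hends, Sym2.eq_iff] at hxy'
    rcases hxy' with ⟨h1, h2⟩ | ⟨h1, h2⟩
    · rw [← h2] at hy'
      rcases hy' with hy | hyh | ⟨hyh, hyu, hyp, hout⟩
      · exact Or.inr (Or.inr (Or.inr (Or.inr ⟨k, hk, hy⟩)))
      · exact Or.inl hyh
      · rw [hb.bdry_blue e x y hends (Or.inr (Set.mem_iUnion.2 ⟨k, hx⟩)) hyh hyu hyp hout] at he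
        exact absurd he (by decide)
    · rw [← h2] at hx'
      exact Or.inr (Or.inr (Or.inr (Or.inr ⟨k, hk, hx'⟩)))

/-- The red edges of the base inside a red u-arm (with `h`) are red in the realisation. -/
lemma CrossBase.insideConfig_U_le {q : PtXG ι κ X G} {j : ι} (hj : q.2.1 j = true) :
    insideConfig ends (U j ∪ {h}) σ ≤ crossReal ends u U p G F σ q := by
  intro e
  by_cases he : insideConfig ends (U j ∪ {h}) σ e = true
  · rw [he]
    obtain ⟨hσe, hw⟩ := insideConfig_eq_true_iff.1 he
    rw [hb.crossReal_U_red hj (hb.touches_U_of_within hw), hσe]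
  · simp only [Bool.not_eq_true] at he
    rw [he]
    exact Bool.false_le _

/-- The red edges of the base inside a red far arm (with `h`) are red in the realisation. -/
lemma CrossBase.insideConfig_F_le {q : PtXG ι κ X G} {k : κ} (hk : q.1 k = true) :
    insideConfig ends (F k ∪ {h}) σ ≤ crossReal ends u U p G F σ q := by
  intro e
  by_cases he : insideConfig ends (F k ∪ {h}) σ e = true
  · rw [he]
    obtain ⟨hσe, hw⟩ := insideConfig_eq_true_iff.1 he
    rw [hb.crossReal_F_red hk (hb.touches_F_of_within hw), hσe]
  · simp only [Bool.not_eq_true] at he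
    rw [he]
    exact Bool.false_le _

/-- The vertex of the graph carried by a vertex of the link graph (`none` = `u`). -/
def linkVert (u : V) (p : X → V) : Option X → V
  | none => u
  | some i => p i

/-- **A walk of the link graph is a red path of the realisation** (an edge for every u–`p i` pair
and every edge of `G`). -/
lemma CrossBase.conn_of_linkWalk (hup : ∀ i, ∃ e, ends e = s(u, p i))
    (hcross : ∀ i j, G.Adj i j → ∃ e, ends e = s(p i, p j)) {q : PtXG ι κ X G} :
    ∀ {x y : Option X}, (GlinkE G q.2.2).Walk x y →
      Conn ends (crossReal ends u U p G F σ q) (linkVert u p x) (linkVert u p y) := by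
  intro x y w
  induction w with
  | nil => exact conn_refl _ _ _
  | @cons x y z hadj _ ih =>
    refine conn_trans ?_ ih
    cases x with
    | none =>
      cases y with
      | none => exact absurd hadj ((GlinkE G q.2.2).loopless.irrefl none)
      | some b =>
        have huP : q.2.2.1 b = true := hadj
        obtain ⟨e, he⟩ := hup b
        have hred : crossReal ends u U p G F σ q e = true := by
          rw [hb.crossReal_apply_UP (show e ∈ clsUPX ends u p b from he), if_pos huP]
          exact hb.u_red e (p b) he
        exact mem_cluster_of_edge (mem_cluster_self _ _ _) hred he
    | some a =>
      cases y with
      | none =>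
        have huP : q.2.2.1 a = true := hadj
        obtain ⟨e, he⟩ := hup a
        have hred : crossReal ends u U p G F σ q e = true := by
          rw [hb.crossReal_apply_UP (show e ∈ clsUPX ends u p a from he), if_pos huP]
          exact hb.u_red e (p a) he
        exact mem_cluster_of_edge (mem_cluster_self _ _ _) hred (ends_swap he)
      | some b =>
        obtain ⟨hab, hc⟩ := hadj
        obtain ⟨e, he⟩ := hcross a b hab
        have hred : crossReal ends u U p G F σ q e = true := by
          rw [hb.crossReal_apply_C (show e ∈ clsCX ends p G ⟨s(a, b), G.mem_edgeSet.2 hab⟩ from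
            ⟨a, b, rfl, he⟩), if_pos hc]
          exact hb.cross_red a b e he
        exact mem_cluster_of_edge (mem_cluster_self _ _ _) hred he

/-- **The red hull formula**: at a point without red-side leak, the red cluster of `h` is
`redSetX`. -/
theorem CrossBase.cluster_crossReal (hup : ∀ i, ∃ e, ends e = s(u, p i))
    (hcross : ∀ i j, G.Adj i j → ∃ e, ends e = s(p i, p j)) {q : PtXG ι κ X G}
    (hq : ¬ LeakRX G q) :
    cluster ends (crossReal ends u U p G F σ q) h = redSetX h u U p G F q := by
  apply Set.Subset.antisymm
  · intro v hv
    exact mem_of_conn_of_closed (hb.redSetX_closed hq)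
      (by rw [mem_redSetX_iff]; exact Or.inl rfl) hv
  · intro v hv
    rw [mem_redSetX_iff] at hv
    have hu : (∃ j, q.2.1 j = true) → u ∈ cluster ends (crossReal ends u U p G F σ q) h := by
      rintro ⟨j, hj⟩
      obtain ⟨e, x, hex, hx⟩ := hb.u_adj_U j
      have hxc : x ∈ cluster ends (crossReal ends u U p G F σ q) h :=
        cluster_mono (hb.insideConfig_U_le hj) h (hb.U_conn j x hx)
      have hred : crossReal ends u U p G F σ q e = true := by
        rw [hb.crossReal_U_red hj ⟨x, hx, u, ends_swap hex⟩]
        exact hb.u_red e x hex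
      exact mem_cluster_of_edge hxc hred (ends_swap hex)
    rcases hv with hvh | ⟨j, hj, hv⟩ | ⟨hvu, hs⟩ | ⟨i, hvp, hs, hatt⟩ | ⟨k, hk, hv⟩
    · rw [hvh]
      exact mem_cluster_self _ _ _
    · exact cluster_mono (hb.insideConfig_U_le hj) h (hb.U_conn j v hv)
    · rw [hvu]
      exact hu hs
    · rw [hvp]
      have hconn := hb.conn_of_linkWalk hup hcross hatt.some
      exact conn_trans (hu hs) (conn_symm hconn)
    · exact cluster_mono (hb.insideConfig_F_le hk) h (hb.F_conn k v hv)

end Hull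

end CrossArm

end Summit.Ventures.PercRepro2
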